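import Mathlib
import HarnessLib
import Summits.AtomisticToContinuum.Crystallization.Theorems.PricedLinkCensusSoftLayerPropagationOneStackingMapSearchDefs
import Summits.AtomisticToContinuum.Crystallization.Theorems.PricedLinkCensusSoftLayerPropagationOneStackingMapSearchLeaf
import Summits.AtomisticToContinuum.Crystallization.Theorems.PricedLinkCensusSoftLayerPropagationOneStackingMapSearchBasic
import Summits.AtomisticToContinuum.Crystallization.Theorems.PricedLinkCensusSoftLayerPropagationOneStackingMapRealizes

/-!
# One-stacking map engine: soundness of the leaf check

Route `PricedLinkCensus`, crux `SoftLayerPropagation` (stmt-AtomisticToContinuum-14233), line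
`Sketch`, stub `stub_oneStackingMap`.  `Dev.Concl A` (a structure in `Type`) is the ONE-STACKING
CONCLUSION in the shadow frame: a layer frame `F ∈ FRAMES` and admissible letters `L` such that
every graph-`5`-ball site in the shadow ball `‖pos‖² ≤ 1089/50` (radius `33/10` at scale
`nn² = 2`) sits at a box stacking point `F.pt k a b (letter L k)`, every such point in the ball is
the position of a `5`-ball site, and `5`-ball sites in the ball have distinct positions.
**`leaf_sound`**: at a LEAF of the search (no cursor site of level `≤ 4`) a realized state with
`leafCheck = true` yields `Dev.Concl`: every `5`-ball site is represented (walk induction through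
the expanded sites, using the level bookkeeping `levelsOK`), `Frame.decomp` is verified by
recomputation, and the exact count `= 1` at every box point in the ball gives surjectivity and
injectivity.  All [folklore].
-/

noncomputable section

namespace Summit.AtomisticToContinuum.Crystallization.Theorems

namespace OneStacking

open V3 St

/-- **The one-stacking conclusion for a development** (shadow frame, scale `nn² = 2`). [folklore] -/
structure Dev.Concl (A : Dev) : Type where
  /-- the layer frame -/
  F : St.Frame
  /-- the letters of the layers `-4 … 4` -/
  L : List ℤ
  /-- the frame is one of the four -/
  F_mem : F ∈ St.FRAMES
  /-- the letters are admissible -/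
  L_ok : St.lettersOK L = true
  /-- membership -/
  mem : ∀ j, (∃ w : A.G.Walk A.i j, w.length ≤ 5) → ‖A.pos j‖ ^ 2 ≤ 1089 / 50 →
    ∃ k a b : ℤ, (-4 ≤ k ∧ k ≤ 4 ∧ -8 ≤ a ∧ a ≤ 8 ∧ -8 ≤ b ∧ b ≤ 8) ∧ A.pos j = toE3 (F.pt k a b (St.letter L k))
  /-- surjectivity -/
  surj : ∀ k a b : ℤ, (-4 ≤ k ∧ k ≤ 4 ∧ -8 ≤ a ∧ a ≤ 8 ∧ -8 ≤ b ∧ b ≤ 8) →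
    ‖toE3 (F.pt k a b (St.letter L k))‖ ^ 2 ≤ 1089 / 50 →
    ∃ j, (∃ w : A.G.Walk A.i j, w.length ≤ 5) ∧ A.pos j = toE3 (F.pt k a b (St.letter L k))
  /-- injectivity -/
  inj : ∀ j j', (∃ w : A.G.Walk A.i j, w.length ≤ 5) → (∃ w : A.G.Walk A.i j', w.length ≤ 5) →
    ‖A.pos j‖ ^ 2 ≤ 1089 / 50 → A.pos j = A.pos j' → j = j'

/-! ### Decoding the checks -/

/-- The shadow ball in integer and in real terms. [folklore] -/
theorem inBall_iff (q : V3) : St.inBall q = true ↔ ‖toE3 q‖ ^ 2 ≤ 1089 / 50 := by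
  rw [St.inBall, decide_eq_true_eq, norm_toE3_sq,
    div_le_div_iff₀ (pow_pos S_real.2 2) (by norm_num : (0:ℝ) < 50)]
  have e : ((1089 * NN2 : ℤ) : ℝ) = 1089 * (S : ℝ) ^ 2 * 2 := by simp only [NN2]; push_cast; ring
  constructor
  · intro h
    have h' : ((100 * V3.n2 q : ℤ) : ℝ) ≤ ((1089 * NN2 : ℤ) : ℝ) := by exact_mod_cast h
    rw [e] at h'; push_cast at h'; linarith
  · intro h
    have h' : ((100 * V3.n2 q : ℤ) : ℝ) ≤ ((1089 * NN2 : ℤ) : ℝ) := by rw [e]; push_cast; linarith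
    exact_mod_cast h'

/-- `Frame.decomp` is verified by recomputation. [folklore] -/
theorem decomp_spec {F : St.Frame} {p : V3} {k a b c : ℤ} (h : F.decomp p = some (k, a, b, c)) :
    p = F.pt k a b c ∧ 0 ≤ c ∧ c ≤ 2 := by
  unfold St.Frame.decomp at h
  simp only at h
  split_ifs at h with hc
  simp only [Option.some.injEq, Prod.mk.injEq] at h
  obtain ⟨rfl, rfl, rfl, rfl⟩ := h
  exact hc

/-- Membership in `BOX`. [folklore] -/
theorem mem_BOX {k a b : ℤ} (h : -4 ≤ k ∧ k ≤ 4 ∧ -8 ≤ a ∧ a ≤ 8 ∧ -8 ≤ b ∧ b ≤ 8) : (k, a, b) ∈ St.BOX := by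
  simp only [St.BOX, List.mem_flatMap, List.mem_map, List.bind_eq_flatMap, List.pure_def, List.mem_singleton,
    List.mem_range]
  simp
  exact ⟨(k + 4).toNat, by omega, (a + 8).toNat, by omega, (b + 8).toNat, by omega, by omega, by omega, by omega⟩

/-- The leaf witness is a frame of `FRAMES` passing `leafOK`. [folklore] -/
theorem leafWitness_spec {s : St} {F : St.Frame} {L : List ℤ} (h : s.leafWitness = some (F, L)) :
    F ∈ St.FRAMES ∧ St.leafOK F L s = true := by
  unfold St.leafWitness at h
  obtain ⟨F', hF', h⟩ := List.exists_of_findSome?_eq_some h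
  revert h
  cases St.readLetters F' s with
  | none => intro h; cases h
  | some L0 =>
    simp only
    intro h
    obtain ⟨L', -, h⟩ := List.exists_of_findSome?_eq_some h
    split_ifs at h with hok
    simp only [Option.some.injEq, Prod.mk.injEq] at h
    obtain ⟨rfl, rfl⟩ := h
    exact ⟨hF', hok⟩

/-- Membership in `inside`. [folklore] -/
theorem mem_inside {s : St} {a : ℕ} : a ∈ s.inside ↔ a < s.size ∧ s.lvl a ≤ 5 ∧ St.inBall (s.pos a) = true := by
  simp [St.inside, List.mem_filter, List.mem_range]

/-- Decoding `leafOK`: membership clause. [folklore] -/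
theorem leafOK_mem {s : St} {F : St.Frame} {L : List ℤ} (h : St.leafOK F L s = true) {a : ℕ} (ha : a ∈ s.inside) :
    ∃ k a' b' : ℤ, (-4 ≤ k ∧ k ≤ 4 ∧ -8 ≤ a' ∧ a' ≤ 8 ∧ -8 ≤ b' ∧ b' ≤ 8) ∧ s.pos a = F.pt k a' b' (St.letter L k) := by
  simp only [St.leafOK, Bool.and_eq_true, List.all_eq_true] at h
  obtain ⟨⟨-, hmem⟩, -⟩ := h
  have := hmem a ha
  revert this
  cases hd : F.decomp (s.pos a) with
  | none => simp
  | some kabc =>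
    obtain ⟨k, a', b', c⟩ := kabc
    simp only [Bool.and_eq_true, decide_eq_true_eq]
    rintro ⟨hbox, hlet⟩
    obtain ⟨hp, -, -⟩ := decomp_spec hd
    exact ⟨k, a', b', hbox, by rw [hp, hlet]⟩

/-- Decoding `leafOK`: the exact count at a box point in the ball. [folklore] -/
theorem leafOK_count {s : St} {F : St.Frame} {L : List ℤ} (h : St.leafOK F L s = true) {k a b : ℤ}
    (hbox : -4 ≤ k ∧ k ≤ 4 ∧ -8 ≤ a ∧ a ≤ 8 ∧ -8 ≤ b ∧ b ≤ 8) (hin : St.inBall (F.pt k a b (St.letter L k)) = true) :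
    (s.inside.filter fun x => s.pos x = F.pt k a b (St.letter L k)).length = 1 := by
  simp only [St.leafOK, Bool.and_eq_true, List.all_eq_true] at h
  obtain ⟨-, hcnt⟩ := h
  have := hcnt (k, a, b) (mem_BOX hbox)
  simp only [hin, Bool.not_true, Bool.false_or, decide_eq_true_eq] at this
  exact this

/-- Decoding `leafOK`: the letters are admissible. [folklore] -/
theorem leafOK_letters {s : St} {F : St.Frame} {L : List ℤ} (h : St.leafOK F L s = true) : St.lettersOK L = true := by
  simp only [St.leafOK, Bool.and_eq_true] at h
  exact h.1.1

/-- Decoding `levelsOK`. [folklore] -/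
theorem levelsOK_spec {s : St} (h : s.levelsOK = true) :
    s.lvl 0 = 0 ∧ (∀ a, a + 1 < s.size → s.lvl a ≤ s.lvl (a + 1)) ∧
      (∀ a, a < s.cur → a < s.size → ∀ b ∈ s.nbrs a, b < s.size ∧ s.lvl b ≤ s.lvl a + 1) := by
  simp only [St.levelsOK, Bool.and_eq_true, decide_eq_true_eq, List.all_eq_true, List.mem_range,
    Bool.or_eq_true, Bool.not_eq_true', decide_eq_false_iff_not] at h
  obtain ⟨h0, hall⟩ := h
  refine ⟨h0, fun a ha => ?_, fun a hac has b hb => ?_⟩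
  · have := (hall a (by omega)).1
    tauto
  · have := (hall a has).2
    rcases this with hna | hb'
    · exact absurd hac hna
    · exact hb' b hb

/-- Levels are monotone along the array. [folklore] -/
theorem lvl_mono {s : St} (h : s.levelsOK = true) {a b : ℕ} (hab : a ≤ b) (hb : b < s.size) : s.lvl a ≤ s.lvl b := by
  obtain ⟨-, hstep, -⟩ := levelsOK_spec h
  induction b with
  | zero => simp at hab; subst hab; exact le_rfl
  | succ b ih =>
    rcases Nat.lt_or_ge a (b + 1) with hlt | hge
    · exact (ih (Nat.lt_succ_iff.1 hlt) (by omega)).trans (hstep b hb)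
    · have : a = b + 1 := le_antisymm hab hge
      subst this; exact le_rfl

/-! ### Every `5`-ball site is represented at a leaf -/

/-- **Coverage at a leaf**: a site joined to the centre by a walk of length `n ≤ 5` is `emb a`
for a site `a` of level `≤ n`. [folklore] -/
theorem covered {A : Dev} {s : St} {emb : ℕ → Fin A.N} (hR : RealizedBy A s emb)
    (hleaf : ¬ (s.cur < s.size ∧ s.lvl s.cur ≤ 4)) (hlev : s.levelsOK = true) :
    ∀ (n : ℕ), n ≤ 5 → ∀ (j : Fin A.N) (w : A.G.Walk A.i j), w.length ≤ n →
      ∃ a, a < s.size ∧ emb a = j ∧ s.lvl a ≤ n := by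
  obtain ⟨h0, -, hnb⟩ := levelsOK_spec hlev
  -- expanded = level ≤ 4, at a leaf
  have hexp : ∀ a, a < s.size → s.lvl a ≤ 4 → a < s.cur := by
    intro a ha hl
    by_contra hac
    push Not at hac
    have hcs : s.cur < s.size := lt_of_le_of_lt hac ha
    have : ¬ s.lvl s.cur ≤ 4 := fun h => hleaf ⟨hcs, h⟩
    exact this ((lvl_mono hlev hac ha).trans hl)
  intro n
  induction n with
  | zero =>
    intro _ j w hw
    have : w.length = 0 := by omega
    have hj : j = A.i := (SimpleGraph.Walk.eq_of_length_eq_zero this).symm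
    subst hj
    exact ⟨0, hR.size_pos, hR.emb_zero, by rw [h0]⟩
  | succ n ih =>
    intro hn j w hw
    -- peel the last edge
    cases hw' : w.reverse with
    | nil => exact ⟨0, hR.size_pos, hR.emb_zero, by rw [h0]; omega⟩
    | @cons _ x _ hadj q =>
      have hlen : w.length = q.length + 1 := by
        rw [← SimpleGraph.Walk.length_reverse, hw', SimpleGraph.Walk.length_cons]
      obtain ⟨a, ha, hax, hal⟩ := ih (by omega) x q.reverse (by rw [SimpleGraph.Walk.length_reverse]; omega)
      have hac : a < s.cur := hexp a ha (by omega)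
      obtain ⟨b, hb, hbj⟩ := hR.doneE a hac j (by rw [hax]; exact hadj.symm)
      obtain ⟨hbs, hbl⟩ := hnb a hac ha b hb
      exact ⟨b, hbs, hbj, by omega⟩

/-! ### Soundness of the leaf check -/

/-- **Soundness of the leaf check** (see the file header). [folklore] -/
theorem leaf_sound {A : Dev} {s : St} {emb : ℕ → Fin A.N} (hR : RealizedBy A s emb)
    (hleaf : ¬ (s.cur < s.size ∧ s.lvl s.cur ≤ 4)) (hchk : s.leafCheck = true) : Nonempty A.Concl := by
  rw [St.leafCheck, Bool.and_eq_true, Option.isSome_iff_exists] at hchk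
  obtain ⟨hlev, ⟨F, L⟩, hw⟩ := hchk
  obtain ⟨hF, hok⟩ := leafWitness_spec hw
  have hcov := covered hR hleaf hlev 5 le_rfl
  -- a `5`-ball site in the ball is `emb a` with `a ∈ inside`
  have rep : ∀ j, (∃ w : A.G.Walk A.i j, w.length ≤ 5) → ‖A.pos j‖ ^ 2 ≤ 1089 / 50 →
      ∃ a ∈ s.inside, emb a = j := by
    rintro j ⟨w, hw⟩ hball
    obtain ⟨a, ha, haj, hal⟩ := hcov j w hw
    refine ⟨a, mem_inside.2 ⟨ha, hal, (inBall_iff _).2 ?_⟩, haj⟩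
    rw [← hR.posE a ha, haj]; exact hball
  refine ⟨⟨F, L, hF, leafOK_letters hok, ?_, ?_, ?_⟩⟩
  · -- membership
    intro j hj hball
    obtain ⟨a, ha, haj⟩ := rep j hj hball
    obtain ⟨k, a', b', hbox, hp⟩ := leafOK_mem hok ha
    refine ⟨k, a', b', hbox, ?_⟩
    rw [← haj, hR.posE a (mem_inside.1 ha).1, hp]
  · -- surjectivity
    intro k a b hbox hball
    have hin : St.inBall (F.pt k a b (St.letter L k)) = true := (inBall_iff _).2 hball
    have hcnt := leafOK_count hok hbox hin
    obtain ⟨x, hx⟩ := List.length_eq_one_iff.1 hcnt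
    have hxm : x ∈ s.inside.filter fun y => s.pos y = F.pt k a b (St.letter L k) := by rw [hx]; simp
    rw [List.mem_filter] at hxm
    obtain ⟨hxi, hxp⟩ := hxm
    obtain ⟨hxs, hxl, -⟩ := mem_inside.1 hxi
    refine ⟨emb x, A.ball_mono hxl (hR.lvlE x hxs), ?_⟩
    rw [hR.posE x hxs, of_decide_eq_true hxp]
  · -- injectivity
    intro j j' hj hj' hball hjj
    obtain ⟨a, ha, rfl⟩ := rep j hj hball
    obtain ⟨a', ha', rfl⟩ := rep _ hj' (by rw [← hjj]; exact hball)
    obtain ⟨k, a1, b1, hbox, hp⟩ := leafOK_mem hok ha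
    have hpos : s.pos a = s.pos a' := toE3_injective (by rw [← hR.posE a (mem_inside.1 ha).1,
      ← hR.posE a' (mem_inside.1 ha').1, hjj])
    have hin : St.inBall (F.pt k a1 b1 (St.letter L k)) = true := by rw [← hp]; exact (mem_inside.1 ha).2.2
    have hcnt := leafOK_count hok hbox hin
    obtain ⟨x, hx⟩ := List.length_eq_one_iff.1 hcnt
    have hmem : ∀ y ∈ s.inside, s.pos y = F.pt k a1 b1 (St.letter L k) → y = x := by
      intro y hy hyp
      have : y ∈ s.inside.filter fun z => s.pos z = F.pt k a1 b1 (St.letter L k) :=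
        List.mem_filter.2 ⟨hy, by simp [hyp]⟩
      rw [hx] at this; simpa using this
    rw [hmem a ha hp, hmem a' ha' (hpos ▸ hp)]

end OneStacking

end Summit.AtomisticToContinuum.Crystallization.Theorems
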